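import Mathlib
import HarnessLib
import Literature.MathematicalPhysics.QuantumFieldTheory.StrongCouplingTorusLimit
import Summits.QuantumFields.YangMills.Theorems.PencilRigidityCurvatureKernelBoundTorusFiniteSizeRateCrossStab

/-!
# `CurvatureKernelBound` — brick `TorusFiniteSizeRate`, support II: explicit cross-stabilisation of
# all ratio jets and of the jets of expectations
# (crux stmt-QuantumFields-11687, line `coupling-trichotomy`)

Continuation of `…TorusFiniteSizeRateCrossStab`: telescoping (`cstabE_of_single`) and strong
induction on the order (`cstabE`) give the cross-stabilisation of all ratio jets with the explicit
torus threshold `2 (r + n + 2) ≤ L` (base points of `H ∪ E` within sup-distance `r` of a lattice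
point); `cstabE_expect` is the tree's `cstab_expect` with the explicit threshold `2 (r + n + 3) ≤ L`
for an observable supported on bonds based within sup-distance `r` of a point (the seed-connected
families `Q` of size `s ≤ n` are used with radius `r + s + 1`, `natAbs_le_of_isSeedConn`), packaged
as the registered sub-goal **`TorusCrossStabExpect`**.

## References

* K. Osterwalder, E. Seiler, *Gauge field theories on a lattice*, Ann. Phys. 110 (1978) 440–471,
  §3, Thms. 3.6–3.7 [OsterwalderSeilerAnnPhys1978].
* E. Seiler, *Gauge Theories as a Problem of Constructive Quantum Field Theory and Statistical
  Mechanics*, LNP 159 (1982), Ch. 2–3 [SeilerLNP1982].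
-/

noncomputable section

open scoped BigOperators Topology
open MeasureTheory Filter
open Literature.MathematicalPhysics Literature.MathematicalPhysics.QuantumFieldTheory
open Literature.Probability.LatticeModels

namespace Summit.QuantumFields.YangMills.Theorems.CurvatureKernel

variable {d N : ℕ} {G : Type*}

section CrossStab

variable [Group G] [TopologicalSpace G] [IsTopologicalGroup G] [CompactSpace G] [MeasurableSpace G]
  [BorelSpace G] {ρ : G →* Matrix (Fin N) (Fin N) ℂ}

/-- **Telescoping** for the explicit cross-stabilisation: single-removal cross-stabilisation at
order `m` (with the explicit torus threshold) gives cross-stabilisation at order `m` for the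
removal of any finite set, with the same threshold. [folklore] -/
theorem cstabE_of_single (hρ : Continuous ρ) {m : ℕ}
    (hs : ∀ (H : Finset (Plaq d)) (q : Plaq d),
      ∃ Λ₀ : Finset (Literature.Probability.LatticeModels.Site d),
        (∀ Λ, Λ₀ ⊆ Λ → JetEq m (ratioZ ρ Λ H {q}) (ratioZ ρ Λ₀ H {q})) ∧
        ∀ (c : Literature.Probability.LatticeModels.Site d) (r L : ℕ),
          (∀ p ∈ H ∪ {q}, ∀ k, (p.1 k - c k).natAbs ≤ r) → 2 * (r + m + 2) ≤ L →
            JetEq m (tratio ρ (L + 1) H {q}) (ratioZ ρ Λ₀ H {q}))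
    (H E : Finset (Plaq d)) :
    ∃ Λ₀ : Finset (Literature.Probability.LatticeModels.Site d),
      (∀ Λ, Λ₀ ⊆ Λ → JetEq m (ratioZ ρ Λ H E) (ratioZ ρ Λ₀ H E)) ∧
      ∀ (c : Literature.Probability.LatticeModels.Site d) (r L : ℕ),
        (∀ p ∈ H ∪ E, ∀ k, (p.1 k - c k).natAbs ≤ r) → 2 * (r + m + 2) ≤ L →
          JetEq m (tratio ρ (L + 1) H E) (ratioZ ρ Λ₀ H E) := by
  classical
  induction E using Finset.induction_on generalizing H with
  | empty =>
    have hone : ∀ Λ : Finset (Literature.Probability.LatticeModels.Site d),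
        (ratioZ ρ Λ H ∅) =ᶠ[𝓝 (0 : ℂ)] fun _ => (1 : ℂ) := by
      intro Λ
      filter_upwards [closedBall_betaOne_mem_nhds d (ρ := ρ)] with β hβ
      rw [Metric.mem_closedBall, dist_zero_right] at hβ
      unfold ratioZ
      rw [Finset.union_empty, div_self (partZ_ne_zero hρ hβ _)]
    have htone : ∀ L : ℕ, (tratio ρ (L + 1) H ∅) =ᶠ[𝓝 (0 : ℂ)] fun _ => (1 : ℂ) := by
      intro L
      have h := PlaqSystem.ratio_empty_eventuallyEq (torusSystem_regular_succ (d := d) hρ L) (tV (L + 1) H)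
      simpa only [tratio, Finset.image_empty] using h
    exact ⟨∅, fun Λ _ => (JetEq.of_eventuallyEq (hone Λ)).trans (JetEq.of_eventuallyEq (hone ∅)).symm,
      fun _ _ L _ _ => (JetEq.of_eventuallyEq (htone L)).trans (JetEq.of_eventuallyEq (hone ∅)).symm⟩
  | insert p E hp ih =>
    obtain ⟨Λa, ha, hta⟩ := ih H
    obtain ⟨Λb, hb, htb⟩ := hs (H ∪ E) p
    have hprod : ∀ Λ : Finset (Literature.Probability.LatticeModels.Site d),
        (ratioZ ρ Λ H (insert p E)) =ᶠ[𝓝 (0 : ℂ)]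
          fun β => ratioZ ρ Λ (H ∪ E) {p} β * ratioZ ρ Λ H E β := by
      intro Λ
      filter_upwards [closedBall_betaOne_mem_nhds d (ρ := ρ)] with β hβ
      rw [Metric.mem_closedBall, dist_zero_right] at hβ
      have hne := partZ_ne_zero hρ hβ (plaquettesIn Λ \ (H ∪ E))
      have e : H ∪ insert p E = H ∪ E ∪ {p} := by
        ext x
        simp only [Finset.mem_union, Finset.mem_insert, Finset.mem_singleton]
        tauto
      unfold ratioZ
      rw [e, div_mul_div_comm, mul_comm (partZ ρ (plaquettesIn Λ \ (H ∪ E)) β), mul_div_mul_right _ _ hne]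
    have htprod : ∀ L : ℕ, (tratio ρ (L + 1) H (insert p E)) =ᶠ[𝓝 (0 : ℂ)]
        fun β => tratio ρ (L + 1) (H ∪ E) {p} β * tratio ρ (L + 1) H E β := by
      intro L
      have h := PlaqSystem.ratio_insert_eventuallyEq (torusSystem_regular_succ (d := d) hρ L) (tV (L + 1) H)
        (E.image (torusProj (L + 1))) (torusProj (L + 1) p)
      rw [← Finset.image_insert, tV_sdiff] at h
      simpa only [tratio, Finset.image_singleton] using h
    refine ⟨Λa ∪ Λb, fun Λ hΛ => ?_, fun c r L hcr hL => ?_⟩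
    · have j1 : JetEq m (ratioZ ρ Λ (H ∪ E) {p}) (ratioZ ρ (Λa ∪ Λb) (H ∪ E) {p}) :=
        (hb Λ (Finset.subset_union_right.trans hΛ)).trans (hb _ Finset.subset_union_right).symm
      have j2 : JetEq m (ratioZ ρ Λ H E) (ratioZ ρ (Λa ∪ Λb) H E) :=
        (ha Λ (Finset.subset_union_left.trans hΛ)).trans (ha _ Finset.subset_union_left).symm
      have j := j1.mul j2 (bddAt_ratioZ hρ _ _ _) (bddAt_ratioZ hρ _ _ _)
      exact ((JetEq.of_eventuallyEq (hprod Λ)).trans j).trans (JetEq.of_eventuallyEq (hprod _)).symm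
    · have hLa : JetEq m (tratio ρ (L + 1) H E) (ratioZ ρ Λa H E) := by
        refine hta c r L (fun p' hp' => hcr p' ?_) hL
        rcases Finset.mem_union.1 hp' with h | h
        · exact Finset.mem_union_left _ h
        · exact Finset.mem_union_right _ (Finset.mem_insert_of_mem h)
      have hLb : JetEq m (tratio ρ (L + 1) (H ∪ E) {p}) (ratioZ ρ Λb (H ∪ E) {p}) := by
        refine htb c r L (fun p' hp' => hcr p' ?_) hL
        rcases Finset.mem_union.1 hp' with h | h
        · rcases Finset.mem_union.1 h with h | h
          · exact Finset.mem_union_left _ h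
          · exact Finset.mem_union_right _ (Finset.mem_insert_of_mem h)
        · exact Finset.mem_union_right _ (by rw [Finset.mem_singleton.1 h]; exact Finset.mem_insert_self _ _)
      have j1 : JetEq m (tratio ρ (L + 1) (H ∪ E) {p}) (ratioZ ρ (Λa ∪ Λb) (H ∪ E) {p}) :=
        hLb.trans (hb _ Finset.subset_union_right).symm
      have j2 : JetEq m (tratio ρ (L + 1) H E) (ratioZ ρ (Λa ∪ Λb) H E) :=
        hLa.trans (ha _ Finset.subset_union_left).symm
      have j := j1.mul j2 (bddAt_ratioZ hρ _ _ _) (bddAt_tratio hρ _ _ _)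
      exact ((JetEq.of_eventuallyEq (htprod L)).trans j).trans (JetEq.of_eventuallyEq (hprod _)).symm

/-- **Explicit cross-stabilisation of all ratio jets** (strong induction on the order): for all
finite `H, E` and every order `n` there is a region `Λ₀` such that the free ratios `R_Λ(H, E)`
have the jet of `R_{Λ₀}(H, E)` to order `n` for `Λ ⊇ Λ₀`, and the torus ratios `R^T_{L+1}(H, E)`
have the same jet for every `L` with `2 (r + n + 2) ≤ L` whenever the base points of `H ∪ E` lie
within sup-distance `r` of a lattice point. [folklore] -/
theorem cstabE (hρ : Continuous ρ) (n : ℕ) (H E : Finset (Plaq d)) :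
    ∃ Λ₀ : Finset (Literature.Probability.LatticeModels.Site d),
      (∀ Λ, Λ₀ ⊆ Λ → JetEq n (ratioZ ρ Λ H E) (ratioZ ρ Λ₀ H E)) ∧
      ∀ (c : Literature.Probability.LatticeModels.Site d) (r L : ℕ),
        (∀ p ∈ H ∪ E, ∀ k, (p.1 k - c k).natAbs ≤ r) → 2 * (r + n + 2) ≤ L →
          JetEq n (tratio ρ (L + 1) H E) (ratioZ ρ Λ₀ H E) := by
  induction n using Nat.strong_induction_on generalizing H E with
  | _ n ih =>
    rcases n with _ | n
    · exact cstabE_zero hρ H E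
    · exact cstabE_of_single hρ
        (fun H' q => cstabE_single hρ (fun m hm H'' E'' => ih m (Nat.lt_succ_of_le hm) H'' E'') H' q) H E

/-! ### Cross-stabilisation of the jets of expectations with an explicit threshold -/

/-- A label touching a bond set based within sup-distance `r` of `c` has base point within
`r + 1` of `c`. [folklore] -/
theorem natAbs_le_of_touches {B : Finset (ZdEdge d)} {c : Literature.Probability.LatticeModels.Site d}
    {r : ℕ} (hB : ∀ e ∈ B, ∀ k, (e.1 k - c k).natAbs ≤ r) {t : Plaq d} (ht : Plaq.Touches B t)
    (k : Fin d) : (t.1 k - c k).natAbs ≤ r + 1 := by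
  obtain ⟨e, het, heB⟩ := Finset.not_disjoint_iff.1 ht
  have h1 := hB e heB k
  rcases Plaq.sub_mem_of_mem_bonds het k with h | h <;> omega

/-- Labels of a seed-connected set of size `≤ s` (seeds touching `B`, `B` based within `r` of `c`)
have base points within `r + s` of `c`. [folklore] -/
theorem natAbs_le_of_isSeedConn {B : Finset (ZdEdge d)} {c : Literature.Probability.LatticeModels.Site d}
    {r s : ℕ} (hB : ∀ e ∈ B, ∀ k, (e.1 k - c k).natAbs ≤ r) {Q : Finset (Plaq d)}
    (hsc : Polymer.IsSeedConn Plaq.Adj (Plaq.Touches B) Q) (hs : Q.card ≤ s) {x : Plaq d}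
    (hx : x ∈ Q) (k : Fin d) : (x.1 k - c k).natAbs ≤ r + s := by
  classical
  obtain ⟨t, ht, hts, htx⟩ := hsc x hx
  have hc : Polymer.IsConn Plaq.Adj (Polymer.comp Plaq.Adj Q t) t := Polymer.isConn_comp ht
  have hxC : x ∈ Polymer.comp Plaq.Adj Q t := Polymer.mem_comp_of_reach ht htx
  have hCQ : Polymer.comp Plaq.Adj Q t ⊆ Q := Polymer.comp_subset Q t
  have h1 := Plaq.natAbs_le_of_isConn hc hxC k
  have h2 := natAbs_le_of_touches hB hts k
  have h3 : (Polymer.comp Plaq.Adj Q t).card ≤ s := (Finset.card_le_card hCQ).trans hs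
  have h4 := hc.card_pos
  omega

/-- **Explicit cross-stabilisation of the jets of expectations.** For a bounded measurable
observable `F` supported on a bond set `B` and every order `n` there is a region `Λ₀` such that
`⟨F⟩_Λ - ⟨F⟩_{Λ₀} = O(β^n)` for all `Λ ⊇ Λ₀` and `⟨F⟩^T_{L+1} - ⟨F⟩_{Λ₀} = O(β^n)` for every `L` with
`2 (r + n + 3) ≤ L`, whenever the bonds of `B` are based within sup-distance `r` of a lattice point
(the tree proof of `cstab_expect` with the explicit windows and `cstabE`). [folklore] -/
theorem cstabE_expect (hρ : Continuous ρ) {B : Finset (ZdEdge d)} {F : ZdGaugeConfig d G → ℂ}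
    (hFm : Measurable F) {C : ℝ} (hFb : ∀ U, ‖F U‖ ≤ C) (hFB : DependsOn F (B : Set (ZdEdge d)))
    (n : ℕ) : ∃ Λ₀ : Finset (Literature.Probability.LatticeModels.Site d),
      (∀ Λ, Λ₀ ⊆ Λ → JetEq n (expect ρ F Λ) (expect ρ F Λ₀)) ∧
        ∀ (c : Literature.Probability.LatticeModels.Site d) (r L : ℕ),
          (∀ e ∈ B, ∀ k, (e.1 k - c k).natAbs ≤ r) → 2 * (r + n + 3) ≤ L →
            JetEq n (texpect ρ (L + 1) F) (expect ρ F Λ₀) := by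
  classical
  set Λb : Finset (Literature.Probability.LatticeModels.Site d) := Plaq.seedBall B n with hΛb
  set SC : Finset (Finset (Plaq d)) := Plaq.smallSeed B n Λb with hSC
  have hst : ∀ Q : Finset (Plaq d), ∃ Λ₀ : Finset (Literature.Probability.LatticeModels.Site d),
      (∀ Λ, Λ₀ ⊆ Λ → JetEq (n - Q.card) (ratioZ ρ Λ ∅ (Plaq.snbAll B Q)) (ratioZ ρ Λ₀ ∅ (Plaq.snbAll B Q))) ∧
      ∀ (c : Literature.Probability.LatticeModels.Site d) (r L : ℕ),
        (∀ p ∈ ∅ ∪ Plaq.snbAll B Q, ∀ k, (p.1 k - c k).natAbs ≤ r) → 2 * (r + (n - Q.card) + 2) ≤ L →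
          JetEq (n - Q.card) (tratio ρ (L + 1) ∅ (Plaq.snbAll B Q)) (ratioZ ρ Λ₀ ∅ (Plaq.snbAll B Q)) :=
    fun Q => cstabE hρ (n - Q.card) ∅ (Plaq.snbAll B Q)
  choose Λ₀ hΛ₀ using hst
  set Λ₁ : Finset (Literature.Probability.LatticeModels.Site d) := Λb ∪ SC.biUnion Λ₀ with hΛ₁
  set Ψ : ℂ → ℂ := fun β => ∑ Q ∈ SC, aPol ρ F Q β * ratioZ ρ (Λ₀ Q) ∅ (Plaq.snbAll B Q) β with hΨ
  -- the `ℤ^d` side (as in `stab_expect`)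
  have mainZ : ∀ Λ : Finset (Literature.Probability.LatticeModels.Site d), Λ₁ ⊆ Λ → JetEq n (expect ρ F Λ) Ψ := by
    intro Λ hΛ
    have hball : Plaq.seedBall B n ⊆ Λ := Finset.subset_union_left.trans hΛ
    have hSCΛ : Plaq.smallSeed B n Λ = SC := Plaq.smallSeed_eq_of_subset hball subset_rfl
    set CΛ := (plaquettesIn Λ).powerset.filter (Polymer.IsSeedConn Plaq.Adj (Plaq.Touches B)) with hCΛ
    set LG := CΛ.filter (fun Q => ¬ Q.card ≤ n) with hLG
    have hsmallset : CΛ.filter (fun Q => Q.card ≤ n) = SC := by rw [← hSCΛ]; rfl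
    have hid : expect ρ F Λ = fun β =>
        ∑ Q ∈ SC, aPol ρ F Q β * ratioZ ρ Λ ∅ (Plaq.snbAll B Q) β +
          ∑ Q ∈ LG, aPol ρ F Q β * ratioZ ρ Λ ∅ (Plaq.snbAll B Q) β := by
      funext β
      rw [expect_eq_sum hρ hFm hFb hFB Λ β, ← Finset.sum_filter_add_sum_filter_not CΛ
        (fun Q => Q.card ≤ n), hsmallset]
    have hsmall : JetEq n (fun β => ∑ Q ∈ SC, aPol ρ F Q β * ratioZ ρ Λ ∅ (Plaq.snbAll B Q) β) Ψ := by
      refine JetEq.sum SC fun Q hQ => ?_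
      have hQΛ : Λ₀ Q ⊆ Λ :=
        (Finset.subset_biUnion_of_mem Λ₀ hQ).trans (Finset.subset_union_right.trans hΛ)
      have h1 := (hΛ₀ Q).1 Λ hQΛ
      have h2 := JetEq.mul_isBigO (aPol_isBigO hρ hFb Q) h1
      have hle : Q.card ≤ n := (Plaq.mem_smallSeed.1 hQ).2.2
      rwa [Nat.add_sub_cancel' hle] at h2
    have hlarge : JetEq n (fun β => ∑ Q ∈ LG, aPol ρ F Q β * ratioZ ρ Λ ∅ (Plaq.snbAll B Q) β)
        (fun _ => 0) := by
      have h := JetEq.sum LG (G := fun _ _ => (0 : ℂ)) fun Q hQ => by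
        have hgt : n ≤ Q.card := by
          have := (Finset.mem_filter.1 hQ).2
          omega
        exact JetEq.of_isBigO (aPol_isBigO hρ hFb Q) (bddAt_ratioZ hρ Λ ∅ (Plaq.snbAll B Q)) hgt
      simpa using h
    rw [hid]
    exact (hsmall.add hlarge).trans (JetEq.of_eventuallyEq (Eventually.of_forall fun β => by simp))
  -- the torus side, for every `L` beyond the explicit threshold
  have mainT : ∀ (c : Literature.Probability.LatticeModels.Site d) (r L : ℕ),
      (∀ e ∈ B, ∀ k, (e.1 k - c k).natAbs ≤ r) → 2 * (r + n + 3) ≤ L →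
        JetEq n (texpect ρ (L + 1) F) Ψ := by
    intro c r L hBc hL
    have hL1 : ∀ Q ∈ SC, JetEq (n - Q.card) (tratio ρ (L + 1) ∅ (Plaq.snbAll B Q))
        (ratioZ ρ (Λ₀ Q) ∅ (Plaq.snbAll B Q)) := by
      intro Q hQ
      obtain ⟨-, hsc, hk⟩ := Plaq.mem_smallSeed.1 hQ
      refine (hΛ₀ Q).2 c (r + Q.card + 1) L (fun p hp k => ?_) (by omega)
      rw [Finset.empty_union] at hp
      rcases Plaq.mem_snbAll.1 hp with hp | ⟨x, hx, hxp⟩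
      · have h1 := natAbs_le_of_touches hBc hp k
        omega
      · have h1 := natAbs_le_of_isSeedConn hBc hsc le_rfl hx k
        have h2 := Plaq.natAbs_sub_le_one_of_adj hxp k
        omega
    have hL2 : Set.InjOn (torusProj (L + 1)) (Plaq.seedBallP (d := d) B (n + 1) : Set (Plaq d)) := by
      refine injOn_torusProj_of_natAbs_le (c := c) (r := r + (n + 2)) (by omega) fun p hp k => ?_
      obtain ⟨t, ht, hpt⟩ := Plaq.mem_seedBallP.1 (Finset.mem_coe.1 hp)
      have h1 := natAbs_le_of_touches hBc (Plaq.mem_seedsOf.1 ht) k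
      have h2 := Plaq.mem_ballP.1 hpt k
      omega
    have hL3 : Set.InjOn (QuantumLattice.torusEdge (d := d) (L + 1))
        ((B ∪ Λb ×ˢ (Finset.univ : Finset (Fin d)) : Finset (ZdEdge d)) : Set (ZdEdge d)) := by
      refine injOn_torusEdge_of_natAbs_le (c := c) (r := r + (n + 2)) (by omega) fun e he k => ?_
      rcases Finset.mem_union.1 (Finset.mem_coe.1 he) with he | he
      · exact (hBc e he k).trans (Nat.le_add_right _ _)
      · have he' := (Finset.mem_product.1 he).1
        obtain ⟨t, ht, het⟩ := Finset.mem_biUnion.1 he'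
        have h1 := natAbs_le_of_touches hBc (Plaq.mem_seedsOf.1 ht) k
        have h2 := Plaq.mem_siteBall.1 het k
        omega
    have hRL := torusSystem_regular_succ (d := d) (G := G) hρ L
    have hFLm : Measurable fun U : ZdGaugeConfig d G => F (U ∘ torusRed (L + 1)) :=
      hFm.comp (measurable_comp_relabel _)
    have hFLb : ∀ U : ZdGaugeConfig d G, ‖F (U ∘ torusRed (L + 1))‖ ≤ C := fun _ => hFb _
    have hFLB : DependsOn (fun U : ZdGaugeConfig d G => F (U ∘ torusRed (L + 1)))
        ((B.image (torusRed (L + 1)) : Finset (ZdEdge d)) : Set (ZdEdge d)) :=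
      dependsOn_comp_torusRed (L + 1) hFB
    set CT := (torusGenuine d (L + 1)).powerset.filter
      (Polymer.IsSeedConn (torusSystem ρ (L + 1)).Adj
        ((torusSystem ρ (L + 1)).Touches (B.image (torusRed (L + 1))))) with hCT
    set LGT := CT.filter (fun Q => ¬ Q.card ≤ n) with hLGT
    have hsmallsetT : CT.filter (fun Q => Q.card ≤ n) = SC.image (Finset.image (torusProj (L + 1))) := by
      ext Q
      rw [Finset.mem_filter, hCT, Finset.mem_filter, Finset.mem_powerset, Finset.mem_image, and_assoc,
        torusSystem_adj_eq]
      exact mem_image_smallSeed_iff ρ hL2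
    have hinjSC : Set.InjOn (Finset.image (torusProj (L + 1))) (SC : Set (Finset (Plaq d))) :=
      injOn_image_smallSeed hL2
    have hterm : ∀ Q ∈ SC, ∀ β : ℂ,
        (torusSystem ρ (L + 1)).aPol (fun U => F (U ∘ torusRed (L + 1))) (Q.image (torusProj (L + 1))) β *
            (torusSystem ρ (L + 1)).ratio (torusGenuine d (L + 1))
              ((torusSystem ρ (L + 1)).snbAll (B.image (torusRed (L + 1)))
                (Q.image (torusProj (L + 1)))) β =
          aPol ρ F Q β * tratio ρ (L + 1) ∅ (Plaq.snbAll B Q) β := by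
      intro Q hQ β
      obtain ⟨hQV, hsc, hk⟩ := Plaq.mem_smallSeed.1 hQ
      have hbonds : B ∪ Q.biUnion Plaq.bonds ⊆ B ∪ Λb ×ˢ (Finset.univ : Finset (Fin d)) := by
        refine Finset.union_subset_union subset_rfl fun e he => ?_
        obtain ⟨p, hp, hep⟩ := Finset.mem_biUnion.1 he
        exact Finset.mem_product.2 ⟨Plaq.fst_mem_of_mem_bonds (hQV hp) hep, Finset.mem_univ _⟩
      rw [aPol_image_torusProj ρ hρ hFm hFB (hL3.mono (by exact_mod_cast hbonds)), snbAll_image_torusProj]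
      simp [tratio, tV]
    have hid : texpect ρ (L + 1) F = fun β =>
        ∑ Q ∈ SC, aPol ρ F Q β * tratio ρ (L + 1) ∅ (Plaq.snbAll B Q) β +
          ∑ Q ∈ LGT, (torusSystem ρ (L + 1)).aPol (fun U => F (U ∘ torusRed (L + 1))) Q β *
            (torusSystem ρ (L + 1)).ratio (torusGenuine d (L + 1))
              ((torusSystem ρ (L + 1)).snbAll (B.image (torusRed (L + 1))) Q) β := by
      funext β
      rw [texpect, PlaqSystem.expect_eq_sum hRL hFLm hFLb hFLB, ← Finset.sum_filter_add_sum_filter_not CT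
        (fun Q => Q.card ≤ n), hsmallsetT, Finset.sum_image hinjSC]
      congr 1
      exact Finset.sum_congr rfl fun Q hQ => hterm Q hQ β
    have hsmall : JetEq n (fun β => ∑ Q ∈ SC, aPol ρ F Q β * tratio ρ (L + 1) ∅ (Plaq.snbAll B Q) β) Ψ := by
      refine JetEq.sum SC fun Q hQ => ?_
      have h2 := JetEq.mul_isBigO (aPol_isBigO hρ hFb Q) (hL1 Q hQ)
      have hle : Q.card ≤ n := (Plaq.mem_smallSeed.1 hQ).2.2
      rwa [Nat.add_sub_cancel' hle] at h2
    have hlarge : JetEq n (fun β => ∑ Q ∈ LGT,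
        (torusSystem ρ (L + 1)).aPol (fun U => F (U ∘ torusRed (L + 1))) Q β *
          (torusSystem ρ (L + 1)).ratio (torusGenuine d (L + 1))
            ((torusSystem ρ (L + 1)).snbAll (B.image (torusRed (L + 1))) Q) β) (fun _ => 0) := by
      have h := JetEq.sum LGT (G := fun _ _ => (0 : ℂ)) fun Q hQ => by
        have hgt : n ≤ Q.card := by
          have := (Finset.mem_filter.1 hQ).2
          omega
        exact JetEq.of_isBigO (PlaqSystem.aPol_isBigO hRL hFLb Q) (PlaqSystem.bddAt_ratio hRL
          (torusGenuine d (L + 1)) ((torusSystem ρ (L + 1)).snbAll (B.image (torusRed (L + 1))) Q)) hgt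
      simpa using h
    rw [hid]
    exact (hsmall.add hlarge).trans (JetEq.of_eventuallyEq (Eventually.of_forall fun β => by simp))
  exact ⟨Λ₁, fun Λ hΛ => (mainZ Λ hΛ).trans (mainZ Λ₁ subset_rfl).symm,
    fun c r L hBc hL => (mainT c r L hBc hL).trans (mainZ Λ₁ subset_rfl).symm⟩

end CrossStab

/-- **Registered sub-goal `TorusCrossStabExpect`** (support II of stub `TorusFiniteSizeRate`): the
explicit cross-stabilisation of the jets of expectations, `cstabE_expect`. [folklore] -/
theorem TorusCrossStabExpect : open Literature.MathematicalPhysics.QuantumFieldTheory in ∀ {d N : ℕ} {G : Type*} [Group G] [TopologicalSpace G] [IsTopologicalGroup G] [CompactSpace G] [MeasurableSpace G] [BorelSpace G] {ρ : G →* Matrix (Fin N) (Fin N) ℂ}, Continuous ρ → ∀ {B : Finset (Literature.MathematicalPhysics.QuantumLattice.ZdEdge d)} {F : ZdGaugeConfig d G → ℂ}, Measurable F → ∀ {C : ℝ}, (∀ U, ‖F U‖ ≤ C) → DependsOn F (B : Set (Literature.MathematicalPhysics.QuantumLattice.ZdEdge d)) → ∀ n : ℕ, ∃ Λ₀ : Finset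 (Literature.Probability.LatticeModels.Site d), (∀ Λ, Λ₀ ⊆ Λ → JetEq n (expect ρ F Λ) (expect ρ F Λ₀)) ∧ ∀ (c : Literature.Probability.LatticeModels.Site d) (r L : ℕ), (∀ e ∈ B, ∀ k, (e.1 k - c k).natAbs ≤ r) → 2 * (r + n + 3) ≤ L → JetEq n (texpect ρ (L + 1) F) (expect ρ F Λ₀) :=
  fun hρ _ _ hFm _ hFb hFB n => cstabE_expect hρ hFm hFb hFB n

end Summit.QuantumFields.YangMills.Theorems.CurvatureKernel

end
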